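/-
Copyright (c) 2026. All rights reserved.
Released under Apache 2.0 license as described in the file LICENSE.
Authors: abc-iut cell, prover seat abc-iut-L4-d1 (gen 9; row «COMPACT-HYP⇒NONAB», F4c: a COMPACT Riemann surface
uniformised by `ℍ` has non-abelian `π₁`; hence every HYPERBOLIC Riemann surface of finite type does, and
[AbsTopIII] Cor. 2.4 (b)(c) is stated at print's hypothesis «hyperbolic Riemann surface of finite type»).
-/
import Literature.AnabelianGeometry.AbsoluteAnabelian.ArchimedeanHolFieldFunctorGeometricPSLAbelianDeckInvariant
import Literature.AnabelianGeometry.AbsoluteAnabelian.ArchimedeanHolFieldFunctorGeometricPSLPuncturedGenuineHyperbolic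
import Literature.AnabelianGeometry.AbsoluteAnabelian.HyperbolicCurveHyperbolicCoreUnconditional
import HarnessLib

/-!
# A hyperbolic Riemann surface of finite type has non-abelian `π₁` — the compact case, and
# [AbsTopIII] Cor. 2.4 (b)(c) at print's hypothesis (PROOF-ONLY)

S. Mochizuki, *Topics in Absolute Anabelian Geometry III*, Cor. 2.4 p.54 («Let `X` be a HYPERBOLIC Riemann
surface of finite type; `U^top → X^top` its universal covering …»), Def. 4.1 (i) p.101, Prop. 4.2 (i) p.106
[MochizukiAbsTopIII2015]; H. M. Farkas, I. Kra, *Riemann Surfaces* (1992), IV.5–IV.6 (the trichotomy by the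
universal covering; the surfaces with abelian `π₁`) [FarkasKra1992].

The tree's Cor. 2.4 (b)(c) column (abc-iut-L4-t8, `HyperbolicCurveHyperbolicCoreUnconditional`) is stated at
«finite type ∧ `π₁` NON-ABELIAN», and `…PSLPuncturedGenuineHyperbolic` (abc-iut-L4-d1 gen 8) proved
«uniformised by `ℍ` ⇒ `π₁` non-abelian» at NON-COMPACT finite type.  Print's hypothesis «hyperbolic Riemann
surface of finite type» also covers the COMPACT surfaces (genus `≥ 2`; `IsOfFiniteType` allows `S = ∅`).
This file closes the compact case and restates the column at print's hypothesis verbatim: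

* ★ `HolRS.exists_mul_ne_mul_fundamentalGroup_of_cover_of_compactSpace` — a COMPACT connected Riemann
  surface `X` admitting a holomorphic covering `k : ℍ → X` has NON-ABELIAN `π₁(X, x₀)`.  Proof: otherwise the
  Möbius deck group `Λ̄ ≅ π₁` of `k` (`exists_pslQuotient_iso_of_cover_pi1`) is an abelian torsion-free
  Fuchsian group, which admits a bounded `Λ̄`-invariant non-constant holomorphic function on `ℍ`
  (`exists_invariant_holomorphic_of_comm`: `Λ̄` is trivial, parabolic-cyclic or hyperbolic-cyclic); it
  descends through `ℍ/Λ̄ ≅ X` (`QuotientManifold.mdifferentiable_invariantEquiv_iff`) to a non-constant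
  holomorphic function on the compact connected `X`, contradicting Mathlib's
  `MDifferentiable.apply_eq_of_compactSpace`.
* ★★ `HolRS.exists_mul_ne_mul_fundamentalGroup_of_cover_of_isOfFiniteType'` — **a HYPERBOLIC (uniformised
  by `ℍ`) connected Riemann surface of finite type has non-abelian `π₁`**, with NO compactness side
  condition (compact: ★; non-compact: gen 8's theorem); `HolRS.nonabelian_fundamentalGroup_iff_exists_cover_of_isOfFiniteType'`
  — at finite type, «`π₁` non-abelian ⟺ uniformised by `ℍ`».
* `exists_mul_ne_mul_fundamentalGroup_of_cover` (and `…_of_compactSpace`, typeclass-carrier forms),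
  ★★ `exists_deckGroup_subset_autIdComponent_of_cover`,
  ★★ `exists_hyperbolicCore_data_of_cover` — **[AbsTopIII] Cor. 2.4 (b) and (c) at print's hypothesis
  «`X` a hyperbolic Riemann surface of finite type»** (a holomorphic covering `ℍ → X` in place of the
  binder «`π₁` non-abelian» of abc-iut-L4-t8's `…_of_nonabelian_fundamentalGroup_holds`); zero named facts.

PROOF-ONLY (no definition, no instance, no named fact); classical; MODEL side of [AbsTopIII] §2/§4 (model ≠
reconstruction ≠ node); nothing here bears on the disputed [IUTchIII] Cor. 3.12.
-/

set_option autoImplicit false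

noncomputable section

namespace Literature.AnabelianGeometry.AbsoluteAnabelian

namespace HolRS

open scoped _root_.Manifold _root_.ContDiff _root_.Topology UpperHalfPlane MatrixGroups
open _root_.MulAction _root_.Function _root_.CategoryTheory _root_.TopologicalSpace
open Literature.Geometry.Manifold (QuotientManifold.invariantEquiv QuotientManifold.invariantEquiv_apply_mk
  QuotientManifold.mdifferentiable_invariantEquiv_iff)

section Compact

variable (X : HolRS)

/-- ★ **A compact Riemann surface uniformised by `ℍ` has non-abelian fundamental group.**  For `X ∈ HolRS`
COMPACT and `k : ℍ → X` a holomorphic covering map, `π₁(X, x₀)` contains two non-commuting elements.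
(Classically: `X` has genus `g ≥ 2` and `π₁` is a surface group; here: an abelian torsion-free Fuchsian group
has a bounded invariant non-constant holomorphic function, which would descend to the compact quotient.)
[cite: FarkasKra1992, IV.6] [cite: MochizukiAbsTopIII2015, Corollary 2.4 p.54] -/
theorem exists_mul_ne_mul_fundamentalGroup_of_cover_of_compactSpace [CompactSpace X.carrier]
    {k : ℍ → X.carrier} (hk : IsCoveringMap k) (dk : MDifferentiable 𝓘(ℂ, ℂ) 𝓘(ℂ, ℂ) k) (x₀ : X.carrier) :
    ∃ a b : FundamentalGroup X.carrier x₀, a * b ≠ b * a := by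
  by_contra hab
  push Not at hab
  -- the Möbius deck group `Λ̄ ≅ π₁` and the iso `ℍ/Λ̄ ≅ X` over `k`
  obtain ⟨Λ, hPD, hC, hΛ, hπΛ, e, he⟩ := exists_pslQuotient_iso_of_cover_pi1 X hk dk
  obtain ⟨φ⟩ := hπΛ x₀
  have hcomm : ∀ p q : Λ, p * q = q * p := fun p q => by
    rw [← φ.apply_symm_apply p, ← φ.apply_symm_apply q, ← map_mul, hab, map_mul]
  -- a bounded `Λ̄`-invariant non-constant holomorphic function on `ℍ`
  obtain ⟨F, hF, -, hFΛ, τ₁, τ₂, hne⟩ := exists_invariant_holomorphic_of_comm Λ hcomm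
  -- descend it to `ℍ/Λ̄`, then to `X`
  haveI : ContinuousConstSMul Λ ℍ := ⟨fun q => continuous_const_smul (q : PSL2R)⟩
  haveI : LocallyCompactSpace ℍ := ChartedSpace.locallyCompactSpace ℂ ℍ
  set Fbar : orbitRel.Quotient Λ ℍ → ℂ := QuotientManifold.invariantEquiv Λ ℍ ℂ ⟨F, hFΛ⟩ with hFbar
  have hFbar_mk : ∀ τ : ℍ, Fbar (Quotient.mk (orbitRel Λ ℍ) τ) = F τ := fun τ =>
    QuotientManifold.invariantEquiv_apply_mk ⟨F, hFΛ⟩ τ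
  have hFbar_d : MDifferentiable 𝓘(ℂ, ℂ) 𝓘(ℂ, ℂ) Fbar :=
    (QuotientManifold.mdifferentiable_invariantEquiv_iff (I := 𝓘(ℂ, ℂ)) (J := 𝓘(ℂ, ℂ)) (n := ω)
      (fun q : Λ => contMDiff_psl_smul (q : PSL2R)) (by simp) ⟨F, hFΛ⟩).mpr hF
  let g : X.carrier → ℂ := fun z => Fbar (e.inv.toFun z)
  have hg : MDifferentiable 𝓘(ℂ, ℂ) 𝓘(ℂ, ℂ) g := hFbar_d.comp e.inv.mdifferentiable
  have hid : ∀ w : (pslQuotient Λ).carrier, e.inv.toFun (e.hom.toFun w) = w := fun w => by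
    have := congrArg (fun f : pslQuotient Λ ⟶ pslQuotient Λ => f.toFun w) e.hom_inv_id
    simp only [comp_toFun, id_toFun, Function.comp_apply, id_eq] at this
    exact this
  have hgk : ∀ τ : ℍ, g (k τ) = F τ := fun τ => by
    simp only [g]
    rw [← he τ, hid]
    exact hFbar_mk τ
  -- a holomorphic function on the compact connected `X` is constant — but `g (k τ₁) = F τ₁ ≠ F τ₂ = g (k τ₂)`
  exact hne (by rw [← hgk τ₁, ← hgk τ₂]; exact hg.apply_eq_of_compactSpace _ _)

/-- ★★ **A hyperbolic Riemann surface of finite type has non-abelian fundamental group** — print's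
hypothesis VERBATIM, no compactness side condition: for `X ∈ HolRS` of finite type (`IsOfFiniteType`) and
`k : ℍ → X` a holomorphic covering map, `π₁(X, x₀)` contains two non-commuting elements (compact case:
`exists_mul_ne_mul_fundamentalGroup_of_cover_of_compactSpace`; non-compact case: abc-iut-L4-d1 gen 8's
`exists_mul_ne_mul_fundamentalGroup_of_cover_of_isOfFiniteType`).
[cite: FarkasKra1992, IV.6] [cite: MochizukiAbsTopIII2015, Corollary 2.4 p.54] -/
theorem exists_mul_ne_mul_fundamentalGroup_of_cover_of_isOfFiniteType' (hX : IsOfFiniteType X.carrier)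
    {k : ℍ → X.carrier} (hk : IsCoveringMap k) (dk : MDifferentiable 𝓘(ℂ, ℂ) 𝓘(ℂ, ℂ) k) (x₀ : X.carrier) :
    ∃ a b : FundamentalGroup X.carrier x₀, a * b ≠ b * a := by
  by_cases hc : CompactSpace X.carrier
  · exact X.exists_mul_ne_mul_fundamentalGroup_of_cover_of_compactSpace hk dk x₀
  · exact X.exists_mul_ne_mul_fundamentalGroup_of_cover_of_isOfFiniteType hX hc hk dk x₀

/-- **At finite type, «`π₁` non-abelian» ⟺ «uniformised by `ℍ`» (hyperbolic)**, no compactness side condition.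
(`⇒`: uniformisation, the tree's `exists_pslQuotient_iso_of_nonabelian_fundamentalGroup_unconditional`;
`⇐`: `exists_mul_ne_mul_fundamentalGroup_of_cover_of_isOfFiniteType'`.)
[cite: FarkasKra1992, IV.6] [cite: MochizukiAbsTopIII2015, Corollary 2.4 p.54] -/
theorem nonabelian_fundamentalGroup_iff_exists_cover_of_isOfFiniteType' (hX : IsOfFiniteType X.carrier)
    (x₀ : X.carrier) :
    (∃ a b : FundamentalGroup X.carrier x₀, a * b ≠ b * a) ↔
      ∃ k : ℍ → X.carrier, IsCoveringMap k ∧ MDifferentiable 𝓘(ℂ, ℂ) 𝓘(ℂ, ℂ) k := by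
  constructor
  · intro hab
    haveI := secondCountableTopology_of_isOfFiniteType X hX
    obtain ⟨k, Λ, _, _, hk, dk, -⟩ := exists_pslQuotient_iso_of_nonabelian_fundamentalGroup_unconditional X x₀ hab
    exact ⟨k, hk, dk⟩
  · rintro ⟨k, hk, dk⟩
    exact X.exists_mul_ne_mul_fundamentalGroup_of_cover_of_isOfFiniteType' hX hk dk x₀

end Compact

end HolRS

/-! ### [AbsTopIII] Cor. 2.4 (b)(c) at print's hypothesis «hyperbolic Riemann surface of finite type» -/

section Cor24

open Set Function Metric
open scoped Manifold ContDiff Topology UpperHalfPlane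
open Literature.Topology.CoveringSpaces
open Literature.Geometry.Kaehler

variable (X : Type) [TopologicalSpace X] [T2Space X] [SecondCountableTopology X] [ConnectedSpace X]
  [ChartedSpace ℂ X] [IsManifold 𝓘(ℂ, ℂ) ω X]

omit [SecondCountableTopology X] in
/-- **A hyperbolic Riemann surface of finite type has non-abelian `π₁`** (typeclass-carrier form of
`HolRS.exists_mul_ne_mul_fundamentalGroup_of_cover_of_isOfFiniteType'`): `X` connected of finite type with a
holomorphic covering `k : ℍ → X` ⇒ `π₁(X, x₀)` non-abelian.
[cite: FarkasKra1992, IV.6] [cite: MochizukiAbsTopIII2015, Corollary 2.4 p.54] -/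
theorem exists_mul_ne_mul_fundamentalGroup_of_cover (hX : IsOfFiniteType X) {k : ℍ → X}
    (hk : IsCoveringMap k) (dk : MDifferentiable 𝓘(ℂ, ℂ) 𝓘(ℂ, ℂ) k) (x₀ : X) :
    ∃ a b : FundamentalGroup X x₀, a * b ≠ b * a :=
  (HolRS.mk X).exists_mul_ne_mul_fundamentalGroup_of_cover_of_isOfFiniteType' hX hk dk x₀

omit [SecondCountableTopology X] in
/-- **A compact Riemann surface uniformised by `ℍ` has non-abelian `π₁`** (typeclass-carrier form of
`HolRS.exists_mul_ne_mul_fundamentalGroup_of_cover_of_compactSpace`; no finite-type hypothesis needed).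
[cite: FarkasKra1992, IV.6] [cite: MochizukiAbsTopIII2015, Corollary 2.4 p.54] -/
theorem exists_mul_ne_mul_fundamentalGroup_of_cover_of_compactSpace [CompactSpace X] {k : ℍ → X}
    (hk : IsCoveringMap k) (dk : MDifferentiable 𝓘(ℂ, ℂ) 𝓘(ℂ, ℂ) k) (x₀ : X) :
    ∃ a b : FundamentalGroup X x₀, a * b ≠ b * a :=
  (HolRS.mk X).exists_mul_ne_mul_fundamentalGroup_of_cover_of_compactSpace hk dk x₀

/-- ★★ **[AbsTopIII] Cor. 2.4 (b) at print's hypothesis**: «Let `X` be a hyperbolic Riemann surface of finite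
type» — `X` connected of finite type, uniformised by `ℍ` (a holomorphic covering `k : ℍ → X`) — then `X` has a
surjective holomorphic universal covering `p : 𝔻 → X` by the unit disc whose deck transformations all lie in
the identity component `Aut⁰(𝔻)` of the Aut-holomorphic disc: «a natural injection
`π₁(X^top) = Aut(U^top/X^top) ↪ Aut⁰(𝕌) ⊆ Aut(𝕌)`».  (abc-iut-L4-t8's
`exists_deckGroup_subset_autIdComponent_of_nonabelian_fundamentalGroup_holds` with its binder «`π₁` non-abelian»
discharged by `exists_mul_ne_mul_fundamentalGroup_of_cover`.)
[cite: MochizukiAbsTopIII2015, Corollary 2.4 (b) p.54] -/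
theorem exists_deckGroup_subset_autIdComponent_of_cover (hX : IsOfFiniteType X) {k : ℍ → X}
    (hk : IsCoveringMap k) (dk : MDifferentiable 𝓘(ℂ, ℂ) 𝓘(ℂ, ℂ) k) (x₀ : X) :
    ∃ p : unitDiscOpens → X, IsCoveringMap p ∧ Function.Surjective p ∧
      MDifferentiable 𝓘(ℂ, ℂ) 𝓘(ℂ, ℂ) p ∧
      ((deckGroup p : Subgroup (unitDiscOpens ≃ₜ unitDiscOpens)) :
          Set (unitDiscOpens ≃ₜ unitDiscOpens)) ⊆
        autIdComponent (AutHolStructure.ofCharted unitDiscOpens) :=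
  exists_deckGroup_subset_autIdComponent_of_nonabelian_fundamentalGroup_holds X hX x₀
    (exists_mul_ne_mul_fundamentalGroup_of_cover X hX hk dk x₀)

/-- ★★ **[AbsTopIII] Cor. 2.4 (c) at print's hypothesis** (up to the printed non-arithmeticity hypothesis,
typed `IsMargulisNonArithmetic` exactly as in abc-iut-L4-t8's column): for `X` connected of finite type
uniformised by `ℍ`, and the holomorphic universal covering `p : 𝔻 → X`, the commensurator `Π` of
`π₁(X) = Aut(𝔻/X)` in `Aut⁰(𝔻)` acts on `𝔻` properly discontinuously, with finite stabilisers, by automorphisms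
of the Aut-holomorphic disc — the hyperbolic-core orbispace data.  (`…_of_nonabelian_fundamentalGroup_holds`
with «`π₁` non-abelian» discharged by `exists_mul_ne_mul_fundamentalGroup_of_cover`.)
[cite: MochizukiAbsTopIII2015, Corollary 2.4 (c) p.55] -/
theorem exists_hyperbolicCore_data_of_cover (hX : IsOfFiniteType X) {k : ℍ → X}
    (hk : IsCoveringMap k) (dk : MDifferentiable 𝓘(ℂ, ℂ) 𝓘(ℂ, ℂ) k) (x₀ : X) :
    ∃ p : unitDiscOpens → X, IsCoveringMap p ∧ Function.Surjective p ∧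
      MDifferentiable 𝓘(ℂ, ℂ) 𝓘(ℂ, ℂ) p ∧
      ∀ G : Subgroup (unitDiscOpens ≃ₜ unitDiscOpens),
        (G : Set (unitDiscOpens ≃ₜ unitDiscOpens)) =
            autIdComponent (AutHolStructure.ofCharted unitDiscOpens) →
        IsMargulisNonArithmetic G (deckGroup p) →
        let Pc : Subgroup (unitDiscOpens ≃ₜ unitDiscOpens) :=
          (Subgroup.Commensurable.commensurator ((deckGroup p).subgroupOf G)).map G.subtype
        (∀ K L : Set unitDiscOpens, IsCompact K → IsCompact L →
            {γ : unitDiscOpens ≃ₜ unitDiscOpens | γ ∈ Pc ∧ (γ '' K ∩ L).Nonempty}.Finite) ∧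
          (∀ x : unitDiscOpens, {γ : unitDiscOpens ≃ₜ unitDiscOpens | γ ∈ Pc ∧ γ x = x}.Finite) ∧
          ((Pc : Set (unitDiscOpens ≃ₜ unitDiscOpens)) ⊆
            autSet (AutHolStructure.ofCharted unitDiscOpens)) :=
  exists_hyperbolicCore_data_of_nonabelian_fundamentalGroup_holds X hX x₀
    (exists_mul_ne_mul_fundamentalGroup_of_cover X hX hk dk x₀)

end Cor24

end Literature.AnabelianGeometry.AbsoluteAnabelian

end
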